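import Summits.BirchSwinnertonDyer.BirchSwinnertonDyer.Theorems.TwoAdicConverseOrdLambdaHalfAtTwoBDPTwoVariableDefs
import Summits.BirchSwinnertonDyer.BirchSwinnertonDyer.Theorems.TwoAdicConverseBDPSelmerLowerDivisibilityAtTwoGaussContent
import Summits.BirchSwinnertonDyer.BirchSwinnertonDyer.Theorems.TwoAdicConverseBDPSelmerLowerDivisibilityAtTwoCharIdealPrincipal
import Literature.NumberTheory.EllipticCurves.ZpExtensionSplitPrimeLineThroughPair
import Literature.NumberTheory.IwasawaTheory.IwasawaAlgebraTwoVar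
import Mathlib.RingTheory.MvPowerSeries.Substitution
import Mathlib.RingTheory.PowerSeries.Binomial
import HarnessLib

/-!
# `anticyclotomic_line_reading_two` — SEAT-2 ANNEX to the node `anticyclotomic-fibre-pinning-two` (O2
# `BDPSelmerLowerDivisibilityAtTwo`, stmt-BirchSwinnertonDyer-24728): the Gauss pin READ ON THE ANTICYCLOTOMIC LINE OF AN
# ARBITRARY FRAME (no adapted pair, no frame covariance), with the general unit-reflecting-hom kernel

crux-ideate seat 2 (lineage `cruxidea-…-24728-2`), round 1, GEN 3, 2026-08-30; lens `decomp` («cofactor localisation / Gauss pin»,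
STATUS 08:47:33Z).  Pen RC-556/RC-563: seat 1's `anticyclotomic-fibre-pinning-two` (09:33Z) and this seat declared ONE lever, so this is
NOT a second card: it is the seat-2 ANNEX (own Lines file; v3 `two_variable_gv_squeeze_two.lean` @528d2d79580d untouched; nothing
registered).  Cruxes files are not library build targets, so §0 re-declares CHARACTER FOR CHARACTER the shared pieces it consumes (U, P0,
R0T, CONTENT and their habitat forms — same normalised signatures as in seat 1's line / the line of record), importing only
accepted `Theorems/` modules (p766427 GaussContent, p766476 CharIdealPrincipal).

WHAT THIS ANNEX ADDS (typed, kernel-checked):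
* §1–§2 `lineSubst` / `lineRes J a b : 𝒪_{ℂ₂}⟦T₁,T₂⟧ →+* 𝒪_{ℂ₂}⟦T⟧`, `T₁ ↦ (1+T)^a − 1`, `T₂ ↦ (1+T)^b − 1` — restriction to the
  `ℤ₂`-quotient LINE with covector `(a, b)` of an ARBITRARY top-generator pair `(γ₁, γ₂)` (Mathlib `MvPowerSeries.substAlgHom` after
  `nestedPowerSeriesEquiv`); PROVED: preserves the augmentation (`constantCoeff_lineSubst`), REFLECTS UNITS (`isUnit_of_isUnit_lineRes`),
  transfers `μ = 0` up (`red₂_ne_zero_of_red₁_lineRes_ne_zero`).  The lead's `TwoAdicBDPLinePin` (p768050) treats the two COORDINATE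
  lines (`constantCoeff`, `map constantCoeff`); seat 1's `FibrePinned` quantifies over an abstract prime `𝔓` of `𝔽̄₂⟦T₁,T₂⟧` and READS it
  (`N_ac`, `Λ_ac`, via `UnrSeries₂.minus`) only on `(κ₁, κ_ac)`-ADAPTED pairs, leaving «all pairs ⟸ ac-pairs» as UNTYPED frame covariance.
  Here the anticyclotomic line is located INSIDE every frame as `ZpExtension.ofLinComb hpair a b hab` with `IsAnticyclotomic`, and the
  reading is the pair `red₁ (lineRes J a b G) ≠ 0` (N) ∧ `red₁ (lineRes J a b G) ∣ red₁ (lineRes J a b C₁)` (Λ) — for EVERY pair.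
* §4 `span_le_span_of_two_pow_mul_eq_of_lineDvd` — the Gauss pin through ANY unit-reflecting ring map `φ : A₂ → 𝒪_{ℂ₂}⟦T⟧`:
  `2^n·G = F·h`, `red₂ F ≠ 0`, `red₁(φ G) ≠ 0`, `red₁(φ G) ∣ red₁(φ F)` ⟹ `(F) ⊆ (G)` (sorry-free; Gauss content p766427 + the unit of
  the domain `𝔽̄₂⟦T⟧` + unit reflection).  With CONTENT (`J C₀ = 2^a·C₁`, `red₂ C₁ ≠ 0`; positive algebraic `μ` allowed) and U this
  gives O2 at the datum: `(J C₀) = (2^a C₁) ⊆ (C₁) ⊆ (G)`.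
* TYPED NODE (sorry-free joins `bdpSelmerLowerDivisibilityAtTwo_of_lineDvd` / `_of_acLineReading`):
  O2 ⟸ P0 (kernel) ∧ CONTENT (kernel) ∧ U (shared research stub) ∧ R0T (shared) ∧ LINEDVD (∃ line: WEAKER seam)
  LINEDVD ⟸ ACLR (leaf: (N) ∧ (Λ) on the in-frame ANTICYCLOTOMIC line, all pairs) — seat 1's `N_ac ∧ Λ_ac` freed of the adapted pair.
  `BDPSelmerLowerDivisibilityAtTwo_of_acLineReading : BDPSelmerLowerDivisibilityAtTwo` concludes the crux BY NAME from the five stubs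
  (sorries exactly U, R0T, ACLR).
HONESTY: nothing here is proved about any curve; BSD is proved for no curve; O2, U, R0T, ACLR stay OPEN; typed ≠ proved.
-/

set_option linter.dupNamespace false
set_option autoImplicit false

noncomputable section

open scoped Classical NumberField
open WeierstrassCurve NumberField IsDedekindDomain Field CategoryTheory Function CongruenceSubgroup
open Literature.NumberTheory.EllipticCurves Literature.NumberTheory.EllipticCurves.Rank1Residual
open Literature.NumberTheory.EllipticCurves.ModularForms
open Literature.NumberTheory.GaloisRepresentations
open Literature.NumberTheory.EllipticCurves.IwasawaAlgebra₂ Literature.NumberTheory.EllipticCurves.UnrSeries₂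
open Literature.NumberTheory.EllipticCurves.YanZhu2026
open Literature.NumberTheory.IwasawaTheory
open Summit.BirchSwinnertonDyer.BirchSwinnertonDyer.Theorems.TwoAdicKatoDeterminant
open Summit.BirchSwinnertonDyer.BirchSwinnertonDyer.Theorems.TwoAdicBDPGaussContent

namespace Summit.BirchSwinnertonDyer.BirchSwinnertonDyer.Cruxes.BDPSelmerLowerDivisibilityAtTwo.AnticyclotomicLineReadingTwo

/-! ## §0 Shared pieces of the line of record `two_variable_gv_squeeze_two` (v3), re-declared character for character -/

/-- `𝒪_{ℂ₂}⟦T₁,T₂⟧` (outer `T₁ ↔ γ₁`, inner `T₂ ↔ γ₂`). [= `TwoVariableGvSqueezeTwo.A₂`] -/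
abbrev A₂ : Type := PowerSeries (PowerSeries (PadicComplexInt 2))

/-- `𝔽̄₂⟦T₁,T₂⟧`. [= `TwoVariableGvSqueezeTwo.Ω₂`] -/
abbrev Ω₂ : Type := PowerSeries (PowerSeries (IsLocalRing.ResidueField (PadicComplexInt 2)))

/-- Coefficientwise reduction `𝒪_{ℂ₂}⟦T₁,T₂⟧ → 𝔽̄₂⟦T₁,T₂⟧`. [= `TwoVariableGvSqueezeTwo.red₂`] -/
def red₂ : A₂ →+* Ω₂ := PowerSeries.map (PowerSeries.map (IsLocalRing.residue (PadicComplexInt 2)))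

/-- **U at `(E,K)`** [= `TwoVariableGvSqueezeTwo.GreenbergUpperInclusionRatAt`, verbatim]: the Euler-system-directional
(UPPER) inclusion at `2` with `2`-power slack, for EVERY admissible frame datum. -/
def GreenbergUpperInclusionRatAt (W : WeierstrassCurve ℚ) [W.IsElliptic] [W.IsGloballyMinimal]
    (K : Type) [Field K] [NumberField K] : Prop :=
  ∀ [IsCMField K] (ι : PadicAlgCl 2 ≃+* ℂ) (v vbar : HeightOneSpectrum (𝓞 K)) (κ₁ κ₂ : ZpExtension K 2)
    (γ₁ γ₂ : absoluteGaloisGroup K) [Fact (ZpExtension.IsTopGeneratorPair κ₁ κ₂ γ₁ γ₂)]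
    [NeZero (W.conductorNorm ℤ)] (f : CuspForm (Gamma0 (W.conductorNorm ℤ)) 2),
    ModularForms.IsNewformOf W f → ∀ [NeZero (NumberField.discr K).natAbs],
    ((2 : ℕ) : 𝓞 K) ∈ v.asIdeal → ((2 : ℕ) : 𝓞 K) ∈ vbar.asIdeal → vbar ≠ v →
    (∀ (w : InfinitePlace K) (k : 𝓞 K), k ∈ v.asIdeal ↔ ‖ι.symm (w.embedding (k : K))‖ < 1) →
    ∀ (Ω δ : ℂ) (Ωp : (unrIntegers 2)ˣ) (LK G : A₂),
      Ω ≠ 0 → (δ ^ 2 = (NumberField.discr K : ℂ) ∨ δ ^ 2 = -(NumberField.discr K : ℂ)) →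
      IsKatzMeasure₂ ι v vbar ∅ κ₁ κ₂ γ₁⁻¹ γ₂⁻¹ 1 Ω δ ((Ωp : unrIntegers 2) : ℂ_[2]) LK →
      IsGreenbergLFunctionFree₂ ι v vbar κ₁ κ₂ γ₁⁻¹ γ₂⁻¹ f (NumberField.discr K).natAbs
        (NumberField.classNumber K) LK G →
      ∀ J : ℤ_[2] →+* PadicComplexInt 2,
        (∀ x : ℤ_[2], ((J x : PadicComplexInt 2) : ℂ_[2]) = ((x : ℚ_[2]) : ℂ_[2])) →
        ∃ m : ℕ, Ideal.span {(2 : A₂) ^ m * G} ≤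
          (WeierstrassCurve.XGr₂.charIdeal (W.baseChange K) 2 κ₁ κ₂ vbar γ₁ γ₂).map (toUnr₂ 2 J)

/-- **P0 at `(E,K)`** [= `TwoVariableGvSqueezeTwo.XGr₂CharIdealPrincipalAt`, verbatim]: principality of the two-variable
characteristic ideal of a torsion `X_Gr(E/K̃_∞)` (kernel algebra, proved: p766476). -/
def XGr₂CharIdealPrincipalAt (W : WeierstrassCurve ℚ) [W.IsElliptic] [W.IsGloballyMinimal]
    (K : Type) [Field K] [NumberField K] : Prop :=
  ∀ (vbar : HeightOneSpectrum (𝓞 K)) (κ₁ κ₂ : ZpExtension K 2) (γ₁ γ₂ : absoluteGaloisGroup K)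
    [Fact (ZpExtension.IsTopGeneratorPair κ₁ κ₂ γ₁ γ₂)],
    Module.IsTorsion (IwasawaAlgebra₂ 2) ((W.baseChange K).XGr₂ 2 κ₁ κ₂ vbar γ₁ γ₂) →
    ∃ C : IwasawaAlgebra₂ 2, WeierstrassCurve.XGr₂.charIdeal (W.baseChange K) 2 κ₁ κ₂ vbar γ₁ γ₂ = Ideal.span {C}

/-- **R0T at `(E,K)`** [= `TwoVariableGvSqueezeTwo.GreenbergFrameTorsionAt`, verbatim]: an admissible frame datum exists at
`2` and `X_Gr(E/K̃_∞)` is `Λ_K`-torsion (the OBJECT half of R). -/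
def GreenbergFrameTorsionAt (W : WeierstrassCurve ℚ) [W.IsElliptic] [W.IsGloballyMinimal]
    (K : Type) [Field K] [NumberField K] : Prop :=
  ∀ [IsCMField K] (ι : PadicAlgCl 2 ≃+* ℂ) (v vbar : HeightOneSpectrum (𝓞 K)) (κ₁ κ₂ : ZpExtension K 2)
    (γ₁ γ₂ : absoluteGaloisGroup K) [Fact (ZpExtension.IsTopGeneratorPair κ₁ κ₂ γ₁ γ₂)]
    [NeZero (W.conductorNorm ℤ)] (f : CuspForm (Gamma0 (W.conductorNorm ℤ)) 2),
    ModularForms.IsNewformOf W f → ∀ [NeZero (NumberField.discr K).natAbs],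
    ((2 : ℕ) : 𝓞 K) ∈ v.asIdeal → ((2 : ℕ) : 𝓞 K) ∈ vbar.asIdeal → vbar ≠ v →
    (∀ (w : InfinitePlace K) (k : 𝓞 K), k ∈ v.asIdeal ↔ ‖ι.symm (w.embedding (k : K))‖ < 1) →
    ∃ (Ω δ : ℂ) (Ωp : (unrIntegers 2)ˣ) (LK G : A₂),
      Ω ≠ 0 ∧ (δ ^ 2 = (NumberField.discr K : ℂ) ∨ δ ^ 2 = -(NumberField.discr K : ℂ)) ∧
      IsKatzMeasure₂ ι v vbar ∅ κ₁ κ₂ γ₁⁻¹ γ₂⁻¹ 1 Ω δ ((Ωp : unrIntegers 2) : ℂ_[2]) LK ∧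
      IsGreenbergLFunctionFree₂ ι v vbar κ₁ κ₂ γ₁⁻¹ γ₂⁻¹ f (NumberField.discr K).natAbs
        (NumberField.classNumber K) LK G ∧
      Module.IsTorsion (IwasawaAlgebra₂ 2) ((W.baseChange K).XGr₂ 2 κ₁ κ₂ vbar γ₁ γ₂)

/-- U on the habitat (β) [= `TwoVariableGvSqueezeTwo.TwoVariableUpperInclusionRatAtTwo`]. Research grade, shared. -/
def TwoVariableUpperInclusionRatAtTwo : Prop :=
  ∀ (W : WeierstrassCurve ℚ) [W.IsElliptic] [W.IsGloballyMinimal],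
    ¬ W.HasCM → GoodOrd W 2 → ¬ W.HasIrreducibleModPGaloisRep 2 →
    ∀ (K : Type) [Field K] [NumberField K],
      (IsImaginaryQuadratic K ∧ SatisfiesHeegnerHypothesis (2 * W.conductorNorm ℤ) K) →
      GreenbergUpperInclusionRatAt W K

/-- P0 on the habitat [= `TwoVariableGvSqueezeTwo.XGr₂CharIdealPrincipalAtTwo`]. Kernel algebra. -/
def XGr₂CharIdealPrincipalAtTwo : Prop :=
  ∀ (W : WeierstrassCurve ℚ) [W.IsElliptic] [W.IsGloballyMinimal] (K : Type) [Field K] [NumberField K],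
    XGr₂CharIdealPrincipalAt W K

/-- R0T on the habitat (β) [= `TwoVariableGvSqueezeTwo.TwoVariableFrameTorsionAtTwo`]. Research grade, shared. -/
def TwoVariableFrameTorsionAtTwo : Prop :=
  ∀ (W : WeierstrassCurve ℚ) [W.IsElliptic] [W.IsGloballyMinimal],
    ¬ W.HasCM → GoodOrd W 2 → ¬ W.HasIrreducibleModPGaloisRep 2 →
    ∀ (K : Type) [Field K] [NumberField K],
      (IsImaginaryQuadratic K ∧ SatisfiesHeegnerHypothesis (2 * W.conductorNorm ℤ) K) →
      GreenbergFrameTorsionAt W K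

/-- **CONTENT** [= seat 1's `AnticyclotomicFibrePinningTwo.TwoContent₂`, verbatim statement]: every non-zero `C₀ ∈ Λ_K = ℤ₂⟦T₁,T₂⟧`
reads along any `J : ℤ₂ → 𝒪_{ℂ₂}` as `J C₀ = 2^a · C₁` with `C₁` PRIMITIVE (`red₂ C₁ ≠ 0`); positive algebraic `μ` is allowed. -/
def TwoContent₂ : Prop :=
  ∀ (J : ℤ_[2] →+* PadicComplexInt 2) (C₀ : IwasawaAlgebra₂ 2), C₀ ≠ 0 →
    ∃ (a : ℕ) (C₁ : A₂), toUnr₂ 2 J C₀ = (2 : A₂) ^ a * C₁ ∧ red₂ C₁ ≠ 0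

/-- `2^a = C(C(2^a))` in `𝒪_{ℂ₂}⟦T₁,T₂⟧` (from p766427 `natCast_pow_eq_C_C`). -/
theorem two_pow_eq_C_C (a : ℕ) :
    (2 : A₂) ^ a = PowerSeries.C (PowerSeries.C ((2 : PadicComplexInt 2) ^ a)) := by
  have h := natCast_pow_eq_C_C (p := 2) a
  simpa only [Nat.cast_ofNat] using h

section Content
open PowerSeries in
/-- **CONTENT holds** (kernel).  PROOF = seat 1's `twoContent₂_holds` (`Lines/anticyclotomic_fibre_pinning_two.lean` §2,
planner-cruxidea-stmt-BirchSwinnertonDyer-24728-1 GEN 3), copied with attribution because Cruxes files are not importable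
(the lead's `TwoAdicBDPPrimePinning.exists_toUnr₂_eq_two_pow_mul_of_ne_zero` is the same port to `Theorems/`). [folklore] -/
theorem twoContent₂_holds : TwoContent₂ := by
  intro J C₀ hC₀
  have hcoef : ∃ ij : ℕ × ℕ, coeff ij.2 (coeff ij.1 C₀) ≠ 0 := by
    by_contra hall
    push Not at hall
    exact hC₀ (PowerSeries.ext fun i => PowerSeries.ext fun j => by simpa using hall (i, j))
  obtain ⟨ij₀, hij₀⟩ := hcoef
  have hirr : Irreducible (2 : ℤ_[2]) := by
    have h := PadicInt.irreducible_p (p := 2)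
    rwa [Nat.cast_ofNat] at h
  obtain ⟨n₀, c, hc, hn₀⟩ := WfDvdMonoid.max_power_factor hij₀ hirr
  have hex : ∃ n : ℕ, ∃ ij : ℕ × ℕ, ¬ ((2 : ℤ_[2]) ^ (n + 1) ∣ coeff ij.2 (coeff ij.1 C₀)) := by
    refine ⟨n₀, ij₀, fun hd => hc ?_⟩
    rw [hn₀, pow_succ] at hd
    exact (mul_dvd_mul_iff_left (pow_ne_zero n₀ hirr.ne_zero)).mp hd
  obtain ⟨a, ha_spec, ha_min⟩ : ∃ a : ℕ, (∃ ij : ℕ × ℕ, ¬ ((2 : ℤ_[2]) ^ (a + 1) ∣ coeff ij.2 (coeff ij.1 C₀))) ∧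
      ∀ n < a, ∀ ij : ℕ × ℕ, (2 : ℤ_[2]) ^ (n + 1) ∣ coeff ij.2 (coeff ij.1 C₀) := by
    refine ⟨Nat.find hex, Nat.find_spec hex, fun n hn ij => ?_⟩
    have hmin := Nat.find_min hex hn
    push Not at hmin
    exact hmin ij
  have hdiv : ∀ ij : ℕ × ℕ, ∃ d : ℤ_[2], coeff ij.2 (coeff ij.1 C₀) = (2 : ℤ_[2]) ^ a * d := by
    intro ij
    rcases Nat.eq_zero_or_pos a with ha | ha
    · exact ⟨coeff ij.2 (coeff ij.1 C₀), by rw [ha, pow_zero, one_mul]⟩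
    · obtain ⟨n, rfl⟩ : ∃ n, a = n + 1 := ⟨a - 1, by omega⟩
      exact ha_min n (Nat.lt_succ_self n) ij
  choose d hd using hdiv
  refine ⟨a, PowerSeries.mk fun i => PowerSeries.mk fun j => J (d (i, j)), ?_, ?_⟩
  · refine PowerSeries.ext fun i => PowerSeries.ext fun j => ?_
    rw [coeff_coeff_toUnr₂, hd (i, j), map_mul, map_pow, map_ofNat, two_pow_eq_C_C, PowerSeries.coeff_C_mul,
      PowerSeries.coeff_C_mul, PowerSeries.coeff_mk, PowerSeries.coeff_mk]
  · obtain ⟨ij₁, hij₁⟩ := ha_spec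
    have hd₁ : ¬ ((2 : ℤ_[2]) ∣ d ij₁) := by
      intro h2d
      apply hij₁
      rw [hd ij₁, pow_succ]
      exact mul_dvd_mul_left _ h2d
    have hunit : IsUnit (d ij₁) := by
      by_contra hnu
      apply hd₁
      have hmem : d ij₁ ∈ IsLocalRing.maximalIdeal ℤ_[2] :=
        (IsLocalRing.mem_maximalIdeal _).mpr (mem_nonunits_iff.mpr hnu)
      rw [PadicInt.maximalIdeal_eq_span_p, Ideal.mem_span_singleton] at hmem
      rwa [Nat.cast_ofNat] at hmem
    intro h0
    have hc := congrArg (fun F : Ω₂ => coeff ij₁.2 (coeff ij₁.1 F)) h0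
    simp only [red₂, PowerSeries.coeff_map, PowerSeries.coeff_mk, map_zero, Prod.mk.eta] at hc
    exact (IsLocalRing.residue_ne_zero_iff_isUnit _).mpr (hunit.map J) hc
end Content

/-! ## §1 Restriction of `𝒪⟦T₁,T₂⟧` to a line through the closed point (generic coefficient ring `𝒪`) -/

section LineSubst

variable {𝒪 : Type} [CommRing 𝒪]

/-- Images `u 0, u 1 ∈ T·𝒪⟦T⟧` are substitutable. -/
theorem hasSubst_line (u : Fin 2 → PowerSeries 𝒪) (hu : ∀ j, PowerSeries.constantCoeff (u j) = 0) :
    MvPowerSeries.HasSubst u :=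
  MvPowerSeries.hasSubst_of_constantCoeff_zero fun j => hu j

/-- **Restriction to a line**: the continuous `𝒪`-algebra map `𝒪⟦T₂⟧⟦T₁⟧ → 𝒪⟦T⟧`, `T₁ ↦ u 0`, `T₂ ↦ u 1`
(`u j ∈ T·𝒪⟦T⟧`), i.e. `F ↦ F(u₀(T), u₁(T))` — Mathlib's `MvPowerSeries.substAlgHom` after `𝒪⟦T₂⟧⟦T₁⟧ ≃ 𝒪⟦T₁,T₂⟧`. -/
def lineSubst (u : Fin 2 → PowerSeries 𝒪) (hu : ∀ j, PowerSeries.constantCoeff (u j) = 0) :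
    PowerSeries (PowerSeries 𝒪) →+* PowerSeries 𝒪 :=
  (MvPowerSeries.substAlgHom (R := 𝒪) (hasSubst_line u hu)).toRingHom.comp
    (nestedPowerSeriesEquiv (R := 𝒪)).toRingHom

theorem lineSubst_apply (u : Fin 2 → PowerSeries 𝒪) (hu : ∀ j, PowerSeries.constantCoeff (u j) = 0)
    (F : PowerSeries (PowerSeries 𝒪)) :
    lineSubst u hu F = MvPowerSeries.subst u (nestedPowerSeriesEquiv (R := 𝒪) F) := by
  show MvPowerSeries.substAlgHom (hasSubst_line u hu) (nestedPowerSeriesEquiv (R := 𝒪) F) = _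
  rw [MvPowerSeries.coe_substAlgHom]

/-- `T₁ ↦ u 0`. -/
theorem lineSubst_X (u : Fin 2 → PowerSeries 𝒪) (hu : ∀ j, PowerSeries.constantCoeff (u j) = 0) :
    lineSubst u hu PowerSeries.X = u 0 := by
  rw [lineSubst_apply, nestedPowerSeriesEquiv_X, MvPowerSeries.subst_X (hasSubst_line u hu)]

/-- `T₂ ↦ u 1`. -/
theorem lineSubst_C_X (u : Fin 2 → PowerSeries 𝒪) (hu : ∀ j, PowerSeries.constantCoeff (u j) = 0) :
    lineSubst u hu (PowerSeries.C PowerSeries.X) = u 1 := by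
  rw [lineSubst_apply, nestedPowerSeriesEquiv_C_X, MvPowerSeries.subst_X (hasSubst_line u hu)]

/-- **Restriction to a line preserves the augmentation**: `(F|_line)(0) = F(0,0)`. -/
theorem constantCoeff_lineSubst (u : Fin 2 → PowerSeries 𝒪) (hu : ∀ j, PowerSeries.constantCoeff (u j) = 0)
    (F : PowerSeries (PowerSeries 𝒪)) :
    PowerSeries.constantCoeff (lineSubst u hu F) = PowerSeries.constantCoeff (PowerSeries.constantCoeff F) := by
  rw [lineSubst_apply]
  show MvPowerSeries.constantCoeff (MvPowerSeries.subst u (nestedPowerSeriesEquiv (R := 𝒪) F)) = _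
  rw [MvPowerSeries.constantCoeff_subst (hasSubst_line u hu), finsum_eq_single _ 0]
  · rw [Finsupp.prod_zero_index, map_one, smul_eq_mul, mul_one, coeff_nestedPowerSeriesEquiv]
    simp
  · intro d hd
    have hs : ∃ s, d s ≠ 0 := by
      by_contra hcon
      push Not at hcon
      exact hd (Finsupp.ext fun s => by simpa using hcon s)
    obtain ⟨s, hs⟩ := hs
    have h0 : MvPowerSeries.constantCoeff (d.prod fun s e => u s ^ e) = 0 := by
      rw [map_finsuppProd, Finsupp.prod]
      exact Finset.prod_eq_zero (Finsupp.mem_support_iff.mpr hs)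
        (by rw [map_pow, show MvPowerSeries.constantCoeff (u s) = 0 from hu s]; exact zero_pow hs)
    rw [h0, smul_zero]

/-- **Restriction to a line reflects units** (`𝒪⟦T₂⟧⟦T₁⟧` and `𝒪⟦T⟧` are augmented: a series is a unit iff its
constant term is). -/
theorem isUnit_of_isUnit_lineSubst (u : Fin 2 → PowerSeries 𝒪) (hu : ∀ j, PowerSeries.constantCoeff (u j) = 0)
    {F : PowerSeries (PowerSeries 𝒪)} (h : IsUnit (lineSubst u hu F)) : IsUnit F := by
  rw [PowerSeries.isUnit_iff_constantCoeff, constantCoeff_lineSubst] at h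
  exact PowerSeries.isUnit_iff_constantCoeff.mpr (PowerSeries.isUnit_iff_constantCoeff.mpr h)

/-- Restriction to a line commutes with coefficientwise maps, in the form needed here: if every coefficient of `F`
dies under `r`, so does every coefficient of `F|_line`. -/
theorem map_lineSubst_eq_zero (u : Fin 2 → PowerSeries 𝒪) (hu : ∀ j, PowerSeries.constantCoeff (u j) = 0)
    {𝒪' : Type} [CommRing 𝒪'] (r : 𝒪 →+* 𝒪') {F : PowerSeries (PowerSeries 𝒪)}
    (hF : PowerSeries.map (PowerSeries.map r) F = 0) : PowerSeries.map r (lineSubst u hu F) = 0 := by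
  have hnat : MvPowerSeries.map r (nestedPowerSeriesEquiv (R := 𝒪) F) =
      nestedPowerSeriesEquiv (R := 𝒪') (PowerSeries.map (PowerSeries.map r) F) := by
    ext d
    simp [coeff_nestedPowerSeriesEquiv, PowerSeries.coeff_map]
  rw [lineSubst_apply]
  show MvPowerSeries.map r (MvPowerSeries.subst u (nestedPowerSeriesEquiv (R := 𝒪) F)) = 0
  rw [MvPowerSeries.map_subst (hasSubst_line u hu), hnat, hF, map_zero,
    ← MvPowerSeries.coe_substAlgHom ((hasSubst_line u hu).map r), map_zero]

end LineSubst

/-! ## §2 One-variable objects at `2` and the lines of an admissible frame -/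

/-- `𝒪_{ℂ₂}⟦T⟧`. -/
abbrev A₁ : Type := PowerSeries (PadicComplexInt 2)

/-- `𝔽̄₂⟦T⟧` (`𝔽̄₂` = residue field of `𝒪_{ℂ₂}`): a discrete valuation ring; ideals `(T^λ)`. -/
abbrev Ω₁ : Type := PowerSeries (IsLocalRing.ResidueField (PadicComplexInt 2))

/-- Coefficientwise reduction `𝒪_{ℂ₂}⟦T⟧ → 𝔽̄₂⟦T⟧`. -/
def red₁ : A₁ →+* Ω₁ := PowerSeries.map (IsLocalRing.residue (PadicComplexInt 2))

/-- `red₂ ∘ C = C ∘ red₁` (constants in the outer variable). -/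
theorem red₂_C (x : A₁) : red₂ (PowerSeries.C x) = PowerSeries.C (red₁ x) := by
  show PowerSeries.map _ (PowerSeries.C x) = _
  rw [PowerSeries.map_C]
  rfl

/-- The images of `T₁, T₂` on the `ℤ₂`-quotient line with covector `(a, b)` of a frame `(γ₁, γ₂)`:
`T₁ ↦ (1+T)^a − 1`, `T₂ ↦ (1+T)^b − 1` (outer `T₁ ↔ γ₁ ↦ a`, inner `T₂ ↔ γ₂ ↦ b`), along `J : ℤ₂ → 𝒪_{ℂ₂}`. -/
def lineImages (J : ℤ_[2] →+* PadicComplexInt 2) (a b : ℤ_[2]) : Fin 2 → A₁ :=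
  ![PowerSeries.map J (PowerSeries.binomialSeries ℤ_[2] a) - 1,
    PowerSeries.map J (PowerSeries.binomialSeries ℤ_[2] b) - 1]

theorem constantCoeff_lineImages (J : ℤ_[2] →+* PadicComplexInt 2) (a b : ℤ_[2]) :
    ∀ j, PowerSeries.constantCoeff (lineImages J a b j) = 0 := by
  have key : ∀ c : ℤ_[2],
      PowerSeries.constantCoeff (PowerSeries.map J (PowerSeries.binomialSeries ℤ_[2] c) - 1) = 0 := by
    intro c
    rw [map_sub, map_one, ← PowerSeries.coeff_zero_eq_constantCoeff_apply, PowerSeries.coeff_map,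
      PowerSeries.coeff_zero_eq_constantCoeff_apply, PowerSeries.binomialSeries_constantCoeff, map_one, sub_self]
  intro j
  fin_cases j
  · exact key a
  · exact key b

/-- **Restriction of `𝒪_{ℂ₂}⟦T₁,T₂⟧` to the line `(a, b)` of the frame.** -/
def lineRes (J : ℤ_[2] →+* PadicComplexInt 2) (a b : ℤ_[2]) : A₂ →+* A₁ :=
  lineSubst (lineImages J a b) (constantCoeff_lineImages J a b)

theorem isUnit_of_isUnit_lineRes (J : ℤ_[2] →+* PadicComplexInt 2) (a b : ℤ_[2]) :
    ∀ x : A₂, IsUnit (lineRes J a b x) → IsUnit x :=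
  fun _ h => isUnit_of_isUnit_lineSubst _ _ h

/-- `μ = 0` on a line forces two-variable `μ = 0`: `red₁ (F|_line) ≠ 0 → red₂ F ≠ 0`. -/
theorem red₂_ne_zero_of_red₁_lineRes_ne_zero (J : ℤ_[2] →+* PadicComplexInt 2) (a b : ℤ_[2]) {F : A₂}
    (h : red₁ (lineRes J a b F) ≠ 0) : red₂ F ≠ 0 :=
  fun hF => h (map_lineSubst_eq_zero _ _ (IsLocalRing.residue (PadicComplexInt 2)) hF)

/-! ## §3 The pieces (binder for binder the `∀`-frame of U of the line of record / of seat 1's `GreenbergAcFibrePinningAt`) -/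

/-- **ACLR at `(E,K)`** — the research LEAF, seat 1's `N_ac ∧ Λ_ac` READ INSIDE AN ARBITRARY FRAME: for every admissible frame
datum, structure map `J`, generator `C₀` of `ch(X_Gr(E/K̃_∞))` and primitive part `C₁` of `J C₀` (`J C₀ = 2^a·C₁`, `red₂ C₁ ≠ 0`),
there is a covector `(a', b')` of the pair `(γ₁, γ₂)` cutting out the ANTICYCLOTOMIC `ℤ₂`-extension such that on that line
(N) `μ(G|_line) = 0` and (Λ) `red(G|_line) ∣ red(C₁|_line)` in the DVR `𝔽̄₂⟦T⟧` («analytic `λ ≤` algebraic `λ`»). -/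
def GreenbergAcLineReadingForallAt (W : WeierstrassCurve ℚ) [W.IsElliptic] [W.IsGloballyMinimal]
    (K : Type) [Field K] [NumberField K] : Prop :=
  ∀ [IsCMField K] (ι : PadicAlgCl 2 ≃+* ℂ) (v vbar : HeightOneSpectrum (𝓞 K)) (κ₁ κ₂ : ZpExtension K 2)
    (γ₁ γ₂ : absoluteGaloisGroup K) [Fact (ZpExtension.IsTopGeneratorPair κ₁ κ₂ γ₁ γ₂)]
    [NeZero (W.conductorNorm ℤ)] (f : CuspForm (Gamma0 (W.conductorNorm ℤ)) 2),
    ModularForms.IsNewformOf W f → ∀ [NeZero (NumberField.discr K).natAbs],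
    ((2 : ℕ) : 𝓞 K) ∈ v.asIdeal → ((2 : ℕ) : 𝓞 K) ∈ vbar.asIdeal → vbar ≠ v →
    (∀ (w : InfinitePlace K) (k : 𝓞 K), k ∈ v.asIdeal ↔ ‖ι.symm (w.embedding (k : K))‖ < 1) →
    ∀ (Ω δ : ℂ) (Ωp : (unrIntegers 2)ˣ) (LK G : A₂),
      Ω ≠ 0 → (δ ^ 2 = (NumberField.discr K : ℂ) ∨ δ ^ 2 = -(NumberField.discr K : ℂ)) →
      IsKatzMeasure₂ ι v vbar ∅ κ₁ κ₂ γ₁⁻¹ γ₂⁻¹ 1 Ω δ ((Ωp : unrIntegers 2) : ℂ_[2]) LK →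
      IsGreenbergLFunctionFree₂ ι v vbar κ₁ κ₂ γ₁⁻¹ γ₂⁻¹ f (NumberField.discr K).natAbs
        (NumberField.classNumber K) LK G →
      ∀ J : ℤ_[2] →+* PadicComplexInt 2,
        (∀ x : ℤ_[2], ((J x : PadicComplexInt 2) : ℂ_[2]) = ((x : ℚ_[2]) : ℂ_[2])) →
        ∀ C₀ : IwasawaAlgebra₂ 2,
          WeierstrassCurve.XGr₂.charIdeal (W.baseChange K) 2 κ₁ κ₂ vbar γ₁ γ₂ = Ideal.span {C₀} →
          ∀ (a : ℕ) (C₁ : A₂), toUnr₂ 2 J C₀ = (2 : A₂) ^ a * C₁ → red₂ C₁ ≠ 0 →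
            ∃ (a' b' : ℤ_[2]) (hab : IsUnit a' ∨ IsUnit b'),
              (ZpExtension.ofLinComb (Fact.out : ZpExtension.IsTopGeneratorPair κ₁ κ₂ γ₁ γ₂) a' b' hab).IsAnticyclotomic ∧
              red₁ (lineRes J a' b' G) ≠ 0 ∧ red₁ (lineRes J a' b' G) ∣ red₁ (lineRes J a' b' C₁)

/-- **LINEDVD at `(E,K)`** — the WEAKER seam actually consumed by the kernel: (N) ∧ (Λ) on SOME `ℤ₂`-quotient line `(a', b')`
of the frame (no anticyclotomicity asked). -/
def GreenbergLineDvdForallAt (W : WeierstrassCurve ℚ) [W.IsElliptic] [W.IsGloballyMinimal]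
    (K : Type) [Field K] [NumberField K] : Prop :=
  ∀ [IsCMField K] (ι : PadicAlgCl 2 ≃+* ℂ) (v vbar : HeightOneSpectrum (𝓞 K)) (κ₁ κ₂ : ZpExtension K 2)
    (γ₁ γ₂ : absoluteGaloisGroup K) [Fact (ZpExtension.IsTopGeneratorPair κ₁ κ₂ γ₁ γ₂)]
    [NeZero (W.conductorNorm ℤ)] (f : CuspForm (Gamma0 (W.conductorNorm ℤ)) 2),
    ModularForms.IsNewformOf W f → ∀ [NeZero (NumberField.discr K).natAbs],
    ((2 : ℕ) : 𝓞 K) ∈ v.asIdeal → ((2 : ℕ) : 𝓞 K) ∈ vbar.asIdeal → vbar ≠ v →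
    (∀ (w : InfinitePlace K) (k : 𝓞 K), k ∈ v.asIdeal ↔ ‖ι.symm (w.embedding (k : K))‖ < 1) →
    ∀ (Ω δ : ℂ) (Ωp : (unrIntegers 2)ˣ) (LK G : A₂),
      Ω ≠ 0 → (δ ^ 2 = (NumberField.discr K : ℂ) ∨ δ ^ 2 = -(NumberField.discr K : ℂ)) →
      IsKatzMeasure₂ ι v vbar ∅ κ₁ κ₂ γ₁⁻¹ γ₂⁻¹ 1 Ω δ ((Ωp : unrIntegers 2) : ℂ_[2]) LK →
      IsGreenbergLFunctionFree₂ ι v vbar κ₁ κ₂ γ₁⁻¹ γ₂⁻¹ f (NumberField.discr K).natAbs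
        (NumberField.classNumber K) LK G →
      ∀ J : ℤ_[2] →+* PadicComplexInt 2,
        (∀ x : ℤ_[2], ((J x : PadicComplexInt 2) : ℂ_[2]) = ((x : ℚ_[2]) : ℂ_[2])) →
        ∀ C₀ : IwasawaAlgebra₂ 2,
          WeierstrassCurve.XGr₂.charIdeal (W.baseChange K) 2 κ₁ κ₂ vbar γ₁ γ₂ = Ideal.span {C₀} →
          ∀ (a : ℕ) (C₁ : A₂), toUnr₂ 2 J C₀ = (2 : A₂) ^ a * C₁ → red₂ C₁ ≠ 0 →
            ∃ (a' b' : ℤ_[2]), red₁ (lineRes J a' b' G) ≠ 0 ∧ red₁ (lineRes J a' b' G) ∣ red₁ (lineRes J a' b' C₁)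

/-- ACLR on the habitat (β) of O2 — research grade, THE leaf of this annex (= seat 1's `N_ac ∧ Λ_ac`, all pairs). -/
def AcLineReadingAtTwo : Prop :=
  ∀ (W : WeierstrassCurve ℚ) [W.IsElliptic] [W.IsGloballyMinimal],
    ¬ W.HasCM → GoodOrd W 2 → ¬ W.HasIrreducibleModPGaloisRep 2 →
    ∀ (K : Type) [Field K] [NumberField K],
      (IsImaginaryQuadratic K ∧ SatisfiesHeegnerHypothesis (2 * W.conductorNorm ℤ) K) →
      GreenbergAcLineReadingForallAt W K

/-- LINEDVD on the habitat (β) of O2 (the weaker seam). -/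
def LineDvdAtTwo : Prop :=
  ∀ (W : WeierstrassCurve ℚ) [W.IsElliptic] [W.IsGloballyMinimal],
    ¬ W.HasCM → GoodOrd W 2 → ¬ W.HasIrreducibleModPGaloisRep 2 →
    ∀ (K : Type) [Field K] [NumberField K],
      (IsImaginaryQuadratic K ∧ SatisfiesHeegnerHypothesis (2 * W.conductorNorm ℤ) K) →
      GreenbergLineDvdForallAt W K

theorem lineDvdAtTwo_of_acLineReadingAtTwo : AcLineReadingAtTwo → LineDvdAtTwo := by
  intro h W _ _ hCM hGO hβ K _ _ hK _ ι v vbar κ₁ κ₂ γ₁ γ₂ _ _ f hf _ hv hvbar hne hι Ω δ Ωp LK G hΩ hδ hLK hG J hJ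
    C₀ hC a C₁ hC₁ hred
  obtain ⟨a', b', _, _, hN, hΛ⟩ :=
    h W hCM hGO hβ K hK ι v vbar κ₁ κ₂ γ₁ γ₂ f hf hv hvbar hne hι Ω δ Ωp LK G hΩ hδ hLK hG J hJ C₀ hC a C₁ hC₁ hred
  exact ⟨a', b', hN, hΛ⟩

/-! ## §4 Kernel algebra (sorry-free) -/

/-- A series in `𝒪_{ℂ₂}⟦T⟧` whose reduction is a unit of `𝔽̄₂⟦T⟧` is a unit. -/
theorem isUnit_of_isUnit_red₁ {x : A₁} (h : IsUnit (red₁ x)) : IsUnit x := by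
  rw [PowerSeries.isUnit_iff_constantCoeff] at h ⊢
  have hc : PowerSeries.constantCoeff (red₁ x) =
      IsLocalRing.residue (PadicComplexInt 2) (PowerSeries.constantCoeff x) := by
    show PowerSeries.constantCoeff (PowerSeries.map _ x) = _
    rw [← PowerSeries.coeff_zero_eq_constantCoeff_apply, PowerSeries.coeff_map,
      PowerSeries.coeff_zero_eq_constantCoeff_apply]
  rw [hc] at h
  exact (IsLocalRing.residue_ne_zero_iff_isUnit _).mp h.ne_zero

/-- **The Gauss pin through a unit-reflecting ring map to `𝒪_{ℂ₂}⟦T⟧`** (pure commutative algebra over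
`A₂ = 𝒪_{ℂ₂}⟦T₁,T₂⟧`): if `2^n·G = F·h` with `red₂ F ≠ 0` (primitive `F`), and for SOME ring map `φ : A₂ → 𝒪_{ℂ₂}⟦T⟧` reflecting
units one has (N) `red₁(φ G) ≠ 0` and (Λ) `red₁(φ G) ∣ red₁(φ F)` in `𝔽̄₂⟦T⟧`, then `(F) ⊆ (G)`.  Proof: Gauss content (p766427) ⇒
`h = 2^n h₀`, `G = F h₀`; reduce along `φ`: `Ḡ = F̄ h̄₀ = q Ḡ h̄₀` in the domain `𝔽̄₂⟦T⟧` with `Ḡ ≠ 0` ⇒ `q h̄₀ = 1` ⇒ `h̄₀`, hence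
`φ h₀`, hence `h₀` is a unit.  (Lead's `TwoAdicBDPLinePin`: the case `φ = constantCoeff` / `map constantCoeff`; seat 1's
`PrimePinning₂`: the case «reduce first, then a prime `𝔓` of the special fibre».) -/
theorem span_le_span_of_two_pow_mul_eq_of_lineDvd (φ : A₂ →+* A₁) (hφ : ∀ x : A₂, IsUnit (φ x) → IsUnit x)
    (F G h : A₂) (n : ℕ) (hFh : (2 : A₂) ^ n * G = F * h) (hF : red₂ F ≠ 0) (hN : red₁ (φ G) ≠ 0)
    (hΛ : red₁ (φ G) ∣ red₁ (φ F)) : Ideal.span {F} ≤ Ideal.span {G} := by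
  have hFh' : ((2 : ℕ) : A₂) ^ n * G = F * h := by rw [Nat.cast_ofNat]; exact hFh
  have hFu : ∃ i : ℕ × ℕ, IsUnit (PowerSeries.coeff i.2 (PowerSeries.coeff i.1 F)) :=
    exists_isUnit_coeff_of_map_map_residue_ne_zero hF
  have hdvd : PowerSeries.C (PowerSeries.C (((2 : ℕ) : PadicComplexInt 2) ^ n)) ∣ F * h :=
    ⟨G, by rw [← hFh', natCast_pow_eq_C_C]⟩
  obtain ⟨h₀, rfl⟩ := C_C_dvd_of_C_C_dvd_mul_of_exists_isUnit_coeff hFu hdvd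
  have hG : G = F * h₀ := by
    refine mul_left_cancel₀ (C_C_ne_zero (pow_ne_zero n (natCast_prime_padicComplexInt_ne_zero (p := 2)))) ?_
    rw [← natCast_pow_eq_C_C, hFh', natCast_pow_eq_C_C]; ring
  obtain ⟨q, hq⟩ := hΛ
  -- in the domain `𝔽̄₂⟦T⟧`: `Ḡ = F̄·h̄₀ = Ḡ·q·h̄₀`, `Ḡ ≠ 0` ⇒ `q·h̄₀ = 1`
  have hunit : IsUnit (red₁ (φ h₀)) := by
    have h1 : red₁ (φ G) * (q * red₁ (φ h₀) - 1) = 0 := by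
      rw [mul_sub, mul_one, sub_eq_zero, ← mul_assoc, ← hq, ← map_mul, ← map_mul, ← hG]
    rcases mul_eq_zero.mp h1 with h0 | h0
    · exact absurd h0 hN
    · exact isUnit_iff_exists_inv'.mpr ⟨q, sub_eq_zero.mp h0⟩
  obtain ⟨u, hu⟩ := hφ h₀ (isUnit_of_isUnit_red₁ hunit)
  refine Ideal.span_singleton_le_span_singleton.mpr ⟨↑u⁻¹, ?_⟩
  rw [hG, ← hu, mul_assoc, Units.mul_inv, mul_one]

/-- **THE NODE, sorry-free**: `O2 ⟸ P0 ∧ CONTENT ∧ U ∧ R0T ∧ LINEDVD` (logic + the Gauss pin on a line of the frame). -/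
theorem bdpSelmerLowerDivisibilityAtTwo_of_lineDvd :
    XGr₂CharIdealPrincipalAtTwo → TwoContent₂ → TwoVariableUpperInclusionRatAtTwo → TwoVariableFrameTorsionAtTwo →
      LineDvdAtTwo → BDPSelmerLowerDivisibilityAtTwo := by
  intro hP hCt hU h0 hpin W _ _ hCM hGO hβ K _ _ hK _ ι v vbar κ₁ κ₂ γ₁ γ₂ _ _ f hf _ hv hvbar hne hι
  obtain ⟨Ω, δ, Ωp, LK, G, hΩ, hδ, hLK, hG, htor⟩ :=
    h0 W hCM hGO hβ K hK ι v vbar κ₁ κ₂ γ₁ γ₂ f hf hv hvbar hne hι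
  refine ⟨Ω, δ, Ωp, LK, G, hΩ, hδ, hLK, hG, htor, fun J hJ => ?_⟩
  obtain ⟨C₀, hC⟩ := hP W K vbar κ₁ κ₂ γ₁ γ₂ htor
  rw [hC, Ideal.map_span, Set.image_singleton]
  by_cases hC0 : C₀ = 0
  · rw [hC0, map_zero, Ideal.span_singleton_zero]
    exact bot_le
  obtain ⟨a, C₁, hC₁, hred⟩ := hCt J C₀ hC0
  obtain ⟨m, hm⟩ := hU W hCM hGO hβ K hK ι v vbar κ₁ κ₂ γ₁ γ₂ f hf hv hvbar hne hι Ω δ Ωp LK G hΩ hδ hLK hG J hJ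
  rw [hC, Ideal.map_span, Set.image_singleton] at hm
  obtain ⟨h, hh⟩ := Ideal.mem_span_singleton'.mp (hm (Ideal.mem_span_singleton_self _))
  have hFh : (2 : A₂) ^ m * G = C₁ * ((2 : A₂) ^ a * h) := by rw [← hh, hC₁]; ring
  obtain ⟨a', b', hN, hΛ⟩ :=
    hpin W hCM hGO hβ K hK ι v vbar κ₁ κ₂ γ₁ γ₂ f hf hv hvbar hne hι Ω δ Ωp LK G hΩ hδ hLK hG J hJ C₀ hC a C₁ hC₁ hred
  have hle : Ideal.span {C₁} ≤ Ideal.span {G} :=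
    span_le_span_of_two_pow_mul_eq_of_lineDvd (lineRes J a' b') (isUnit_of_isUnit_lineRes J a' b') C₁ G _ m hFh hred
      hN hΛ
  exact le_trans (Ideal.span_singleton_le_span_singleton.mpr ⟨(2 : A₂) ^ a, by rw [hC₁, mul_comm]⟩) hle

/-- **THE NODE with the research leaf**: `O2 ⟸ P0 ∧ CONTENT ∧ U ∧ R0T ∧ ACLR`, sorry-free. -/
theorem bdpSelmerLowerDivisibilityAtTwo_of_acLineReading :
    XGr₂CharIdealPrincipalAtTwo → TwoContent₂ → TwoVariableUpperInclusionRatAtTwo → TwoVariableFrameTorsionAtTwo →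
      AcLineReadingAtTwo → BDPSelmerLowerDivisibilityAtTwo :=
  fun hP hCt hU h0 hac =>
    bdpSelmerLowerDivisibilityAtTwo_of_lineDvd hP hCt hU h0 (lineDvdAtTwo_of_acLineReadingAtTwo hac)

/-! ## §5 Stubs of THIS annex (NOT registered — single-slot ruling RC-555) and the composition BY NAME -/

/-- **stub P0** (KERNEL, proved — p766476 — drop-in by name, exactly as in the line of record / seat 1's line). -/
theorem stub_charIdealPrincipal : XGr₂CharIdealPrincipalAtTwo :=
  fun W _ _ K _ _ vbar κ₁ κ₂ γ₁ γ₂ _ h =>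
    Summit.BirchSwinnertonDyer.BirchSwinnertonDyer.Theorems.TwoAdicBDPCharIdealPrincipal.exists_xGr₂_charIdeal_eq_span_two
      W K vbar κ₁ κ₂ γ₁ γ₂ h

/-- **stub CONTENT** (KERNEL, proved in §0: seat 1's `twoContent₂_holds`, re-proved here since Cruxes files do not import). -/
theorem stub_twoContent : TwoContent₂ := twoContent₂_holds

/-- **stub U** (research, SHARED statement with the line of record's `stub_upperInclusionRat`). -/
theorem stub_upperInclusionRat : TwoVariableUpperInclusionRatAtTwo := by
  sorry

/-- **stub R0T** (research, SHARED statement `TwoVariableFrameTorsionAtTwo` of the line of record / seat 1's line). -/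
theorem stub_frameTorsion : TwoVariableFrameTorsionAtTwo := by
  sorry

/-- **stub ACLR** (research, THE LEAF of this annex): `N_ac ∧ Λ_ac` on the in-frame anticyclotomic line, all pairs. -/
theorem stub_acLineReading : AcLineReadingAtTwo := by
  sorry

/-- **Composition BY NAME**: the crux `BDPSelmerLowerDivisibilityAtTwo` from `stub_charIdealPrincipal` (P0, kernel),
`stub_twoContent` (CONTENT, kernel), `stub_upperInclusionRat` (U), `stub_frameTorsion` (R0T), `stub_acLineReading` (ACLR). -/
theorem BDPSelmerLowerDivisibilityAtTwo_of_acLineReading : BDPSelmerLowerDivisibilityAtTwo :=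
  bdpSelmerLowerDivisibilityAtTwo_of_acLineReading stub_charIdealPrincipal stub_twoContent stub_upperInclusionRat
    stub_frameTorsion stub_acLineReading

end Summit.BirchSwinnertonDyer.BirchSwinnertonDyer.Cruxes.BDPSelmerLowerDivisibilityAtTwo.AnticyclotomicLineReadingTwo

end
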